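import Literature.NumberTheory.Rogawski1990.FinExplicitTransferFactorInertPlaceEigenvalues   -- ★ p840547 (brings ★ (D2) `FinExplicitTransferFactorInertPlaceValuation`)
import HarnessLib

/-!
# The `Δ‴`-exponent dictionary at an inert place, in ROOT coordinates: `ord_w χ_g(u) = N₁ + N₂` for `N₁ = ord_w(α − b)`, `N₂ = ord_w(γ − b)`, and the ultrametric
# trichotomy of `(N₁, N₂, N)` (Flicker 1998, pp. 74–75, §6 Thm. 15; Rogawski 1990, §4.9 p. 55)

Topic `NumberTheory/Rogawski1990`; namespace `Literature.NumberTheory.Rogawski1990`.  THEOREMS ONLY (no definition, no named fact, no instance, no notation, no `sorry`;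
count-neutral for the books).  Cell `pub/hodgecm-mathlib`, F0∕P3a road «D-N7-inert», line «N7nsCount» (architect A-p06 (g26)), brick **(S0-D2) «THE `Δ‴`-EXPONENT
DICTIONARY»** = SPEC-F12 §(S0) (S0-D2) + (S0-ultra) (`F0/P3a/A-p06/g26/SPEC-F12-countSplitClause-assembly.A-p06g26.md`; LEAD F0P3a-plan (g9) WORD T8-51 (B)).  Sibling of ★
p840547 `FinExplicitTransferFactorInertPlaceEigenvalues` (the same dictionary through an EIGENFRAME of a matching `γ′`); here through the ROOTS of `χ_g` in the local FIELD
`L_w` — the currency of the (F0) one-place model (F0P3-p02) and of the stub `stub_countSplitClause` (`hsplit : ∃ x, (χ_{g,w}).IsRoot x`).  HONEST LABEL: HC_CM is proved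
only modulo the printed citations until rung 0 closes; no letter here.

THE MATHEMATICS.  `γ_H = (g, u) ∈ H_v`, `w` the place above a non-split `v`, `χ := χ_{g,w} = (finCharpolyTwo L v γ_H).map eval_w ∈ L_w[X]` (monic quadratic), `b := u_w`.
If `χ` has two distinct roots `α ≠ γ` in `L_w` (torus `(E¹)³`, SPEC (S0): «`a` := the root `hsplit` gives, `c` := the other»), then `χ = (X − α)(X − γ)` (§2), so
`χ_g(u)_w = (b − α)(b − γ)` and `ord_w χ_g(u) = N₁ + N₂` with `N₁ = ord_w(α − b)`, `N₂ = ord_w(γ − b)` — in Mathlib's convention `v_w(ϖ) = exp(−1)`: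
`log v_w(χ_g(u)_w) = −(N₁ + N₂)` (**`log_valued_eval_finCharpolyTwo_apply_eq_neg_add`**), so ★ (D2) reads `Δ‴_v(γ_H, γ′) = (−q)^{−(N₁+N₂)} · κ_v`
(**`finExplicitDelta_eq_neg_absNorm_zpow_neg_add_mul_kappa`**) — Flicker's `Δ_{G∕H}(t) = (−q)^{−N₁−N₂}`.  And since `α − γ = (α − b) − (γ − b)`, the exponents satisfy the
ULTRAMETRIC TRICHOTOMY «the two smallest of `N₁, N₂, N` are equal», `N = ord_w(α − γ)`, in the exact disjunction of ★ `Flicker1998.flicker_theorem15`'s hypothesis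
(**`flicker_exponents_trichotomy`**, §1).  All heads are symmetric under `α ↔ γ`, `N₁ ↔ N₂`.

* §1 valued-field lemmas at `L_w`: `exists_nat_valued_eq_exp_neg` (an integral non-zero element has `v = exp(−N)`, `N : ℕ`), **`flicker_exponents_trichotomy`**.
* §2 type (1): `map_finCharpolyTwo_eq_mul_of_isRoot`, `eval_finCharpolyTwo_finGammaTwo_apply_eq`, **`log_valued_eval_finCharpolyTwo_apply_eq_neg_add`**, `isUnit_eval_finCharpolyTwo_of_isRoot`,
  **`finExplicitDelta_eq_neg_absNorm_zpow_neg_add_mul_kappa`**, `flicker_exponents_trichotomy_of_roots`.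
NOT here: the type (2) (irreducible `χ_g`, torus `(EL)¹ × E¹`) exponent `n = min(1+2N, 2+2N₂)` — FILE 2 once the (F11) currency for `N, N₂` is spelled.

## References
* [Flicker1998UnitaryFL] Y. Z. Flicker, *Elementary proof of the fundamental lemma for a unitary group*, Canad. J. Math. 50 (1998), pp. 74–75 (`N₁, N₂`, `Δ = (−q)^{−N₁−N₂}`), §6 Thm. 15 p. 95.
* [Rogawski1990] J. D. Rogawski, *Automorphic Representations of Unitary Groups in Three Variables*, Ann. of Math. Stud. 123 (1990), §4.9 p. 55 (`n₁₂, n₂₃`), Prop. 4.9.1 (b).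
* [Omeara1963] O. T. O'Meara, *Introduction to Quadratic Forms* (1963), §11 (the principle of domination in a non-archimedean valued field).
-/

set_option autoImplicit false

noncomputable section

open NumberField IsDedekindDomain Matrix Polynomial
open scoped MatrixGroups

namespace Literature.NumberTheory.Rogawski1990

open Literature.NumberTheory.Automorphic Literature.NumberTheory.GaloisRepresentations Literature.NumberTheory.QuadraticForms
open Literature.NumberTheory.NumberFields

variable (L : Type) [Field L] [NumberField L] [IsCMField L] (v : HeightOneSpectrum (𝓞 ↥(maximalRealSubfield L)))
  (w : UnitaryGroup.PlacesOver L v)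

/-! ## §1 Valued-field lemmas at `L_w` -/

section ValuedField

omit [IsCMField L] in
/-- **An integral non-zero element has valuation `exp(−N)` for a natural number `N = ord_w x`** (Mathlib: `v_w(ϖ) = exp(−1)`). [cite: Omeara1963, §11] -/
theorem exists_nat_valued_eq_exp_neg {x : w.1.adicCompletion L} (hx0 : x ≠ 0) (hx : Valued.v x ≤ 1) :
    ∃ N : ℕ, Valued.v x = WithZero.exp (-(N : ℤ)) := by
  have hv0 : Valued.v x ≠ 0 := (Valuation.ne_zero_iff _).2 hx0
  have hlog : WithZero.log (Valued.v x) ≤ 0 := by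
    rw [WithZero.log_le_iff_le_exp hv0, WithZero.exp_zero]
    exact hx
  refine ⟨(-WithZero.log (Valued.v x)).toNat, ?_⟩
  rw [Int.toNat_of_nonneg (by omega), neg_neg, WithZero.exp_log hv0]

omit [IsCMField L] in
/-- **THE ULTRAMETRIC TRICHOTOMY OF FLICKER'S EXPONENTS**: if `v_w(x) = exp(−N₁)`, `v_w(y) = exp(−N₂)` and `v_w(x − y) = exp(−N)` then the two smallest of `N₁, N₂, N` are
equal — `(N₁ = N₂ ∧ N₁ ≤ N) ∨ (N₁ = N ∧ N₁ ≤ N₂) ∨ (N₂ = N ∧ N₂ ≤ N₁)`, the exact hypothesis of ★ `Flicker1998.flicker_theorem15` (principle of domination: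
`v(x − y) = max(v x, v y)` when `v x ≠ v y`, `≤` when equal).  Applied to `x = α − b`, `y = γ − b`, `x − y = α − γ`.
[cite: Omeara1963, §11] [cite: Flicker1998UnitaryFL, §6 Thm. 15 p. 95] -/
theorem flicker_exponents_trichotomy {x y : w.1.adicCompletion L} {N₁ N₂ N : ℕ}
    (hx : Valued.v x = WithZero.exp (-(N₁ : ℤ))) (hy : Valued.v y = WithZero.exp (-(N₂ : ℤ)))
    (hxy : Valued.v (x - y) = WithZero.exp (-(N : ℤ))) :
    (N₁ = N₂ ∧ N₁ ≤ N) ∨ (N₁ = N ∧ N₁ ≤ N₂) ∨ (N₂ = N ∧ N₂ ≤ N₁) := by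
  rcases lt_trichotomy N₁ N₂ with h12 | h12 | h12
  · -- `N₁ < N₂`: `v y < v x`, so `v (x − y) = v x`, `N = N₁`
    have hlt : Valued.v y < Valued.v x := by
      rw [hx, hy, WithZero.exp_lt_exp]; omega
    have h := Valuation.map_sub_eq_of_lt_left _ hlt
    rw [hxy, hx, WithZero.exp_inj] at h
    exact Or.inr (Or.inl ⟨by omega, h12.le⟩)
  · -- `N₁ = N₂`: `v (x − y) ≤ max = v x`, so `N₁ ≤ N`
    subst h12
    have h := Valuation.map_sub (Valued.v) x y
    rw [hxy, hx, hy, max_self, WithZero.exp_le_exp] at h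
    exact Or.inl ⟨rfl, by omega⟩
  · -- `N₂ < N₁`
    have hlt : Valued.v x < Valued.v y := by
      rw [hx, hy, WithZero.exp_lt_exp]; omega
    have h := Valuation.map_sub_eq_of_lt_right _ hlt
    rw [hxy, hy, WithZero.exp_inj] at h
    exact Or.inr (Or.inr ⟨by omega, h12.le⟩)

end ValuedField

/-! ## §2 Type (1): the roots of `χ_{g,w}` lie in `L_w` -/

section SplitTorus

variable (a : (UnitaryGroup.cmDatum L 2 (Matrix.of fun i j : Fin 2 => if i.val + j.val + 1 = 2 then (1 : L) else 0)).Local v ×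
      (UnitaryGroup.cmDatum L 1 (Matrix.of fun i j : Fin 1 => if i.val + j.val + 1 = 1 then (1 : L) else 0)).Local v)

/-- A monic quadratic over a field with two distinct roots is their product of linear factors. [folklore] -/
private theorem eq_mul_X_sub_C_of_monic_of_natDegree_two {K : Type*} [Field K] {p : K[X]} (hp : p.Monic) (hdeg : p.natDegree = 2)
    {α γ : K} (hα : p.IsRoot α) (hγ : p.IsRoot γ) (hαγ : α ≠ γ) : p = (X - C α) * (X - C γ) := by
  classical
  have hp0 : p ≠ 0 := hp.ne_zero
  -- the roots multiset contains `{α, γ}` and has at most `2` elements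
  have hsub : ({α, γ} : Multiset K) ≤ p.roots := by
    rw [Multiset.le_iff_count]
    intro x
    rw [Multiset.insert_eq_cons, Multiset.count_cons, Multiset.count_singleton]
    by_cases hxα : x = α
    · subst hxα
      rw [if_neg hαγ, if_pos rfl, zero_add]
      exact (Polynomial.count_roots p).symm ▸ (Polynomial.rootMultiplicity_pos hp0).2 hα
    · rw [if_neg hxα, add_zero]
      by_cases hxγ : x = γ
      · subst hxγ
        rw [if_pos rfl]
        exact (Polynomial.count_roots p).symm ▸ (Polynomial.rootMultiplicity_pos hp0).2 hγ
      · rw [if_neg hxγ]; exact Nat.zero_le _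
  have hcard : ({α, γ} : Multiset K).card = 2 := by
    rw [Multiset.insert_eq_cons, Multiset.card_cons, Multiset.card_singleton]
  have hle : p.roots.card ≤ 2 := hdeg ▸ Polynomial.card_roots' p
  have hroots : p.roots = {α, γ} := (Multiset.eq_of_le_of_card_le hsub (by rw [hcard]; exact hle)).symm
  have hsplit : p.roots.card = p.natDegree := by rw [hroots, hcard, hdeg]
  rw [← Polynomial.prod_multiset_X_sub_C_of_monic_of_roots_card_eq hp hsplit, hroots, Multiset.insert_eq_cons, Multiset.map_cons,
    Multiset.prod_cons, Multiset.map_singleton, Multiset.prod_singleton]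

/-- **`χ_{g,w} = (X − α)(X − γ)`** for two distinct roots `α ≠ γ ∈ L_w` of the monic quadratic `χ_{g,w} = (finCharpolyTwo L v γ_H).map eval_w`. [cite: Flicker1998UnitaryFL, pp. 74–75] -/
theorem map_finCharpolyTwo_eq_mul_of_isRoot {α γ : w.1.adicCompletion L}
    (hα : ((finCharpolyTwo L v a).map (Pi.evalRingHom (fun w' : UnitaryGroup.PlacesOver L v => w'.1.adicCompletion L) w)).IsRoot α)
    (hγ : ((finCharpolyTwo L v a).map (Pi.evalRingHom (fun w' : UnitaryGroup.PlacesOver L v => w'.1.adicCompletion L) w)).IsRoot γ) (hαγ : α ≠ γ) :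
    (finCharpolyTwo L v a).map (Pi.evalRingHom (fun w' : UnitaryGroup.PlacesOver L v => w'.1.adicCompletion L) w) = (X - C α) * (X - C γ) := by
  have hmonic : ((finCharpolyTwo L v a).map (Pi.evalRingHom (fun w' : UnitaryGroup.PlacesOver L v => w'.1.adicCompletion L) w)).Monic := by
    unfold finCharpolyTwo
    exact (Matrix.charpoly_monic _).map _
  have hdeg : ((finCharpolyTwo L v a).map (Pi.evalRingHom (fun w' : UnitaryGroup.PlacesOver L v => w'.1.adicCompletion L) w)).natDegree = 2 := by
    unfold finCharpolyTwo
    rw [(Matrix.charpoly_monic _).natDegree_map, Matrix.charpoly_natDegree_eq_dim, Fintype.card_fin]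
  exact eq_mul_X_sub_C_of_monic_of_natDegree_two hmonic hdeg hα hγ hαγ

/-- **`χ_g(u)_w = (b − α)(b − γ)`**, `b = u_w = finGammaTwo L v γ_H w`. [cite: Flicker1998UnitaryFL, pp. 74–75] [cite: Rogawski1990, §4.9 p. 55] -/
theorem eval_finCharpolyTwo_finGammaTwo_apply_eq {α γ : w.1.adicCompletion L}
    (hα : ((finCharpolyTwo L v a).map (Pi.evalRingHom (fun w' : UnitaryGroup.PlacesOver L v => w'.1.adicCompletion L) w)).IsRoot α)
    (hγ : ((finCharpolyTwo L v a).map (Pi.evalRingHom (fun w' : UnitaryGroup.PlacesOver L v => w'.1.adicCompletion L) w)).IsRoot γ) (hαγ : α ≠ γ) :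
    ((finCharpolyTwo L v a).eval (finGammaTwo L v a)) w = (finGammaTwo L v a w - α) * (finGammaTwo L v a w - γ) := by
  have h : ((finCharpolyTwo L v a).eval (finGammaTwo L v a)) w =
      ((finCharpolyTwo L v a).map (Pi.evalRingHom (fun w' : UnitaryGroup.PlacesOver L v => w'.1.adicCompletion L) w)).eval (finGammaTwo L v a w) := by
    rw [Polynomial.eval_map]
    exact (Polynomial.eval₂_at_apply (Pi.evalRingHom (fun w' : UnitaryGroup.PlacesOver L v => w'.1.adicCompletion L) w) (finGammaTwo L v a)).symm
  rw [h, map_finCharpolyTwo_eq_mul_of_isRoot L v w a hα hγ hαγ, eval_mul, eval_sub, eval_sub, eval_X, eval_C, eval_C]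

/-- **(S0-D2) `log v_w(χ_g(u)_w) = −(N₁ + N₂)`** for `N₁ = ord_w(α − b)`, `N₂ = ord_w(γ − b)` — `ord_w χ_g(u) = N₁ + N₂`, so ★ (D2) reads `Δ‴_v = (−q)^{−(N₁+N₂)} · κ_v`
(Flicker's `Δ_{G∕H}(t) = (−q)^{−N₁−N₂}`, Rogawski's `n₁₂ + n₂₃`). [cite: Flicker1998UnitaryFL, pp. 74–75] [cite: Rogawski1990, §4.9 p. 55] -/
theorem log_valued_eval_finCharpolyTwo_apply_eq_neg_add {α γ : w.1.adicCompletion L}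
    (hα : ((finCharpolyTwo L v a).map (Pi.evalRingHom (fun w' : UnitaryGroup.PlacesOver L v => w'.1.adicCompletion L) w)).IsRoot α)
    (hγ : ((finCharpolyTwo L v a).map (Pi.evalRingHom (fun w' : UnitaryGroup.PlacesOver L v => w'.1.adicCompletion L) w)).IsRoot γ) (hαγ : α ≠ γ)
    {N₁ N₂ : ℕ} (hN₁ : Valued.v (α - finGammaTwo L v a w) = WithZero.exp (-(N₁ : ℤ))) (hN₂ : Valued.v (γ - finGammaTwo L v a w) = WithZero.exp (-(N₂ : ℤ))) :
    WithZero.log (Valued.v (((finCharpolyTwo L v a).eval (finGammaTwo L v a)) w)) = -((N₁ : ℤ) + N₂) := by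
  rw [eval_finCharpolyTwo_finGammaTwo_apply_eq L v w a hα hγ hαγ, map_mul, Valuation.map_sub_swap, hN₁, Valuation.map_sub_swap, hN₂, ← WithZero.exp_add,
    WithZero.log_exp]
  ring

/-- `χ_g(u)` is a UNIT at a non-split `v` when `χ_{g,w}` has two distinct roots off `b` (its `w`-component is `(b − α)(b − γ) ≠ 0`; ★ `isUnit_localRing_of_ne_zero_of_subsingleton`).
[cite: Rogawski1990, §4.9 p. 55] -/
theorem isUnit_eval_finCharpolyTwo_of_isRoot (hv : Subsingleton (UnitaryGroup.PlacesOver L v)) {α γ : w.1.adicCompletion L}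
    (hα : ((finCharpolyTwo L v a).map (Pi.evalRingHom (fun w' : UnitaryGroup.PlacesOver L v => w'.1.adicCompletion L) w)).IsRoot α)
    (hγ : ((finCharpolyTwo L v a).map (Pi.evalRingHom (fun w' : UnitaryGroup.PlacesOver L v => w'.1.adicCompletion L) w)).IsRoot γ) (hαγ : α ≠ γ)
    (hαb : α ≠ finGammaTwo L v a w) (hγb : γ ≠ finGammaTwo L v a w) :
    IsUnit ((finCharpolyTwo L v a).eval (finGammaTwo L v a)) := by
  refine isUnit_localRing_of_ne_zero_of_subsingleton L v hv fun h0 => ?_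
  have hw0 : ((finCharpolyTwo L v a).eval (finGammaTwo L v a)) w = 0 := by rw [h0]; rfl
  rw [eval_finCharpolyTwo_finGammaTwo_apply_eq L v w a hα hγ hαγ] at hw0
  rcases mul_eq_zero.1 hw0 with h | h
  · exact hαb (sub_eq_zero.1 h).symm
  · exact hγb (sub_eq_zero.1 h).symm

variable (H' : Matrix (Fin 3) (Fin 3) L) (b : (UnitaryGroup.cmDatum L 3 H').Local v) (hw : IsCMField.complexConj L • w.1 = w.1)

include hw in
open scoped Classical in
/-- **`Δ‴_v(γ_H, γ′) = (−q)^{−(N₁+N₂)} · κ_v(γ_H, γ′)` IN ROOT COORDINATES** (★ (D2) `finExplicitDelta_eq_neg_absNorm_zpow_mul_kappa_of_nonsplit_of_isUnramifiedIn` with the exponent read by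
`log_valued_eval_finCharpolyTwo_apply_eq_neg_add`): non-split `v` unramified in `L`, `μ` unramified at `w` under the N7 μ-guard, a matching pair `ι_v(γ_H) ↔ γ′`, two distinct
roots `α ≠ γ ∈ L_w` of `χ_{g,w}` off `b = u_w`, `N₁ = ord_w(α − b)`, `N₂ = ord_w(γ − b)`. [cite: Flicker1998UnitaryFL, pp. 74–75] [cite: Rogawski1990, §4.9 p. 55, Prop. 4.9.1 (b)] -/
theorem finExplicitDelta_eq_neg_absNorm_zpow_neg_add_mul_kappa (μ : HeckeCharacter L)
    (hμω : ∀ x : ideleGroup ↥(maximalRealSubfield L), μ (AdeleRing.ideleBaseChange ↥(maximalRealSubfield L) L x) = quadraticHeckeCharCM L x)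
    (hunr : Algebra.IsUnramifiedIn (𝓞 L) v.asIdeal) (hμ : μ.IsUnramifiedAt w.1) (h : IsLocalNormPair L H' v a b)
    {α γ : w.1.adicCompletion L}
    (hα : ((finCharpolyTwo L v a).map (Pi.evalRingHom (fun w' : UnitaryGroup.PlacesOver L v => w'.1.adicCompletion L) w)).IsRoot α)
    (hγ : ((finCharpolyTwo L v a).map (Pi.evalRingHom (fun w' : UnitaryGroup.PlacesOver L v => w'.1.adicCompletion L) w)).IsRoot γ) (hαγ : α ≠ γ)
    {N₁ N₂ : ℕ} (hN₁ : Valued.v (α - finGammaTwo L v a w) = WithZero.exp (-(N₁ : ℤ))) (hN₂ : Valued.v (γ - finGammaTwo L v a w) = WithZero.exp (-(N₂ : ℤ))) :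
    finExplicitDelta L v H' a μ b = (-(Ideal.absNorm v.asIdeal : ℂ)) ^ (-((N₁ : ℤ) + N₂)) * ((finKappaAt L v H' a b : ℤ) : ℂ) := by
  have hv : Subsingleton (UnitaryGroup.PlacesOver L v) :=
    UnitaryGroup.PlacesOver.subsingleton_of_smul_eq (IsCMField.complexConj L) (IsCMField.complexConj_ne_one L) w hw
  have hαb : α ≠ finGammaTwo L v a w := fun h0 => by
    rw [h0, sub_self, map_zero] at hN₁; exact WithZero.zero_ne_coe hN₁
  have hγb : γ ≠ finGammaTwo L v a w := fun h0 => by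
    rw [h0, sub_self, map_zero] at hN₂; exact WithZero.zero_ne_coe hN₂
  have hu : IsUnit ((finCharpolyTwo L v a).eval (finGammaTwo L v a)) := isUnit_eval_finCharpolyTwo_of_isRoot L v w a hv hα hγ hαγ hαb hγb
  have hD := finExplicitDelta_eq_neg_absNorm_zpow_mul_kappa_of_nonsplit_of_isUnramifiedIn L v H' a b w hw μ hμω hunr hμ h hu
  have hlog := log_valued_eval_finCharpolyTwo_apply_eq_neg_add L v w a hα hγ hαγ hN₁ hN₂
  rw [hD, hlog]

/-- **(S0-ultra) FOR THE ROOTS**: `N₁ = ord_w(α − b)`, `N₂ = ord_w(γ − b)`, `N = ord_w(α − γ)` satisfy the trichotomy of ★ `Flicker1998.flicker_theorem15` (§1 at `x = α − b`,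
`y = γ − b`, `x − y = α − γ`). [cite: Flicker1998UnitaryFL, §6 Thm. 15 p. 95] [cite: Omeara1963, §11] -/
theorem flicker_exponents_trichotomy_of_roots {α γ : w.1.adicCompletion L} {N₁ N₂ N : ℕ}
    (hN₁ : Valued.v (α - finGammaTwo L v a w) = WithZero.exp (-(N₁ : ℤ))) (hN₂ : Valued.v (γ - finGammaTwo L v a w) = WithZero.exp (-(N₂ : ℤ)))
    (hN : Valued.v (α - γ) = WithZero.exp (-(N : ℤ))) :
    (N₁ = N₂ ∧ N₁ ≤ N) ∨ (N₁ = N ∧ N₁ ≤ N₂) ∨ (N₂ = N ∧ N₂ ≤ N₁) := by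
  refine flicker_exponents_trichotomy L v w hN₁ hN₂ ?_
  rw [sub_sub_sub_cancel_right]
  exact hN

end SplitTorus

/-! ## §3 Type (2): `χ_{g,w}` irreducible over `L_w` — the exponent law `n = min(2N+1, 2M)` (ED. 2)

B-p14 (g30) 2026-09-01T04:42:03Z dictionary (confirmed against the THM-18 table incl. the `M = 0` stratum): `n := ord_w χ_g(u)`, `N` by `ord_w(disc χ_{g,w}) = 2N + 1`
(the splitting field `L_w(λ)` is RAMIFIED over `L_w`, so the discriminant has ODD order — a HYPOTHESIS here), `M := ord_w(tr g − 2u)` (Flicker's `N₂ + 1`); then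
`4·χ_g(u) = (tr g − 2u)² − disc χ` and the two orders `2M` (even), `2N + 1` (odd) never cancel: **`n = min(2N+1, 2M)`** — pure `L_w`-arithmetic, no `EL`. -/

section IrredTorus

open scoped Valued

variable (a : (UnitaryGroup.cmDatum L 2 (Matrix.of fun i j : Fin 2 => if i.val + j.val + 1 = 2 then (1 : L) else 0)).Local v ×
      (UnitaryGroup.cmDatum L 1 (Matrix.of fun i j : Fin 1 => if i.val + j.val + 1 = 1 then (1 : L) else 0)).Local v)
  (H' : Matrix (Fin 3) (Fin 3) L) (b : (UnitaryGroup.cmDatum L 3 H').Local v) (hw : IsCMField.complexConj L • w.1 = w.1)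

omit [IsCMField L] in
/-- **THE TYPE-(2) EXPONENT LAW IN A VALUED FIELD** (`v(2) = 1`): if `v(t² − 4d) = exp(−(2N+1))` (odd order) and `v(t − 2b) = exp(−M)`, then
`v(b² − t b + d) = exp(−min(2N+1, 2M))` — from `4(b² − tb + d) = (t − 2b)² − (t² − 4d)` and the principle of domination (the orders `2M ≠ 2N+1` differ in parity).
[cite: Flicker1998UnitaryFL, §6 Thm. 18 p. 97 (`n = min(1+2N, 2+2N₂)`)] [cite: Omeara1963, §11] -/
theorem valued_quadratic_eval_eq_exp_neg_min (h2 : Valued.v (2 : w.1.adicCompletion L) = 1) {t d b : w.1.adicCompletion L} {N M : ℕ}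
    (hN : Valued.v (t ^ 2 - 4 * d) = WithZero.exp (-((2 * N + 1 : ℕ) : ℤ))) (hM : Valued.v (t - 2 * b) = WithZero.exp (-(M : ℤ))) :
    Valued.v (b ^ 2 - t * b + d) = WithZero.exp (-((min (2 * N + 1) (2 * M) : ℕ) : ℤ)) := by
  have key : (4 : w.1.adicCompletion L) * (b ^ 2 - t * b + d) = (t - 2 * b) ^ 2 - (t ^ 2 - 4 * d) := by ring
  have h4 : Valued.v (4 : w.1.adicCompletion L) = 1 := by
    rw [show (4 : w.1.adicCompletion L) = 2 * 2 by norm_num, map_mul, h2, one_mul]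
  have hx : Valued.v ((t - 2 * b) ^ 2) = WithZero.exp (-(2 * (M : ℤ))) := by
    rw [map_pow, hM, pow_two, ← WithZero.exp_add]
    congr 1; ring
  have hval : Valued.v (b ^ 2 - t * b + d) = Valued.v ((t - 2 * b) ^ 2 - (t ^ 2 - 4 * d)) := by
    rw [← key, map_mul, h4, one_mul]
  rw [hval]
  rcases Nat.lt_or_ge (2 * M) (2 * N + 1) with hlt | hge
  · -- `v(disc) < v((t − 2b)²)`: the square dominates, `min = 2M`
    have h : Valued.v (t ^ 2 - 4 * d) < Valued.v ((t - 2 * b) ^ 2) := by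
      rw [hx, hN, WithZero.exp_lt_exp]; push_cast; omega
    rw [Valuation.map_sub_eq_of_lt_left _ h, hx, min_eq_right hlt.le]
    push_cast; ring_nf
  · -- `2N + 1 ≤ 2M`, in fact `<` (parity): the discriminant dominates, `min = 2N + 1`
    have hlt : 2 * N + 1 < 2 * M := lt_of_le_of_ne hge (by omega)
    have h : Valued.v ((t - 2 * b) ^ 2) < Valued.v (t ^ 2 - 4 * d) := by
      rw [hx, hN, WithZero.exp_lt_exp]; push_cast; omega
    rw [Valuation.map_sub_eq_of_lt_right _ h, hN, min_eq_left hlt.le]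

omit [IsCMField L] in
/-- … in `log` form: `log v(b² − tb + d) = −min(2N+1, 2M)`. [cite: Flicker1998UnitaryFL, §6 Thm. 18 p. 97] -/
theorem log_valued_quadratic_eval_eq_neg_min (h2 : Valued.v (2 : w.1.adicCompletion L) = 1) {t d b : w.1.adicCompletion L} {N M : ℕ}
    (hN : Valued.v (t ^ 2 - 4 * d) = WithZero.exp (-((2 * N + 1 : ℕ) : ℤ))) (hM : Valued.v (t - 2 * b) = WithZero.exp (-(M : ℤ))) :
    WithZero.log (Valued.v (b ^ 2 - t * b + d)) = -((min (2 * N + 1) (2 * M) : ℕ) : ℤ) := by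
  rw [valued_quadratic_eval_eq_exp_neg_min L v w h2 hN hM, WithZero.log_exp]

omit [IsCMField L] in
/-- The companion when `t = 2b` (`M = ∞`, capped): `v(b² − tb + d) = v(t² − 4d) = exp(−(2N+1))` (`4(b² − tb + d) = −(t² − 4d)`). [cite: Flicker1998UnitaryFL, §6 Thm. 18 p. 97] -/
theorem valued_quadratic_eval_eq_exp_neg_of_eq (h2 : Valued.v (2 : w.1.adicCompletion L) = 1) {t d b : w.1.adicCompletion L} {N : ℕ}
    (hN : Valued.v (t ^ 2 - 4 * d) = WithZero.exp (-((2 * N + 1 : ℕ) : ℤ))) (ht : t = 2 * b) :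
    Valued.v (b ^ 2 - t * b + d) = WithZero.exp (-((2 * N + 1 : ℕ) : ℤ)) := by
  have key : (4 : w.1.adicCompletion L) * (b ^ 2 - t * b + d) = -(t ^ 2 - 4 * d) := by rw [ht]; ring
  have h4 : Valued.v (4 : w.1.adicCompletion L) = 1 := by
    rw [show (4 : w.1.adicCompletion L) = 2 * 2 by norm_num, map_mul, h2, one_mul]
  have hval : Valued.v (b ^ 2 - t * b + d) = Valued.v (t ^ 2 - 4 * d) := by
    rw [← Valuation.map_neg _ (t ^ 2 - 4 * d), ← key, map_mul, h4, one_mul]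
  rw [hval, hN]

/-- **`χ_g(u)_w = b² − tr(g_w)·b + det(g_w)`**, `g_w := g.map eval_w`, `b = u_w` (Mathlib `Matrix.charpoly_fin_two` over the field `L_w`). [cite: Rogawski1990, §4.9 p. 55] -/
theorem eval_finCharpolyTwo_finGammaTwo_apply_eq_quadratic :
    ((finCharpolyTwo L v a).eval (finGammaTwo L v a)) w =
      finGammaTwo L v a w ^ 2 -
        ((a.1.val.val : Matrix (Fin 2) (Fin 2) (UnitaryGroup.LocalRing L v)).map
          (Pi.evalRingHom (fun w' : UnitaryGroup.PlacesOver L v => w'.1.adicCompletion L) w)).trace * finGammaTwo L v a w +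
        ((a.1.val.val : Matrix (Fin 2) (Fin 2) (UnitaryGroup.LocalRing L v)).map
          (Pi.evalRingHom (fun w' : UnitaryGroup.PlacesOver L v => w'.1.adicCompletion L) w)).det := by
  have h : ((finCharpolyTwo L v a).eval (finGammaTwo L v a)) w =
      ((finCharpolyTwo L v a).map (Pi.evalRingHom (fun w' : UnitaryGroup.PlacesOver L v => w'.1.adicCompletion L) w)).eval (finGammaTwo L v a w) := by
    rw [Polynomial.eval_map]
    exact (Polynomial.eval₂_at_apply (Pi.evalRingHom (fun w' : UnitaryGroup.PlacesOver L v => w'.1.adicCompletion L) w) (finGammaTwo L v a)).symm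
  rw [h, finCharpolyTwo, ← Matrix.charpoly_map, Matrix.charpoly_fin_two]
  simp only [eval_add, eval_sub, eval_mul, eval_pow, eval_C, eval_X]

/-- **(S0′-D2) THE TYPE-(2) EXPONENT LAW ON THE CM CARRIERS**: with `g_w := γ₂.map eval_w`, `b := u_w`, `v_w(2) = 1`, `v_w(disc χ_{g,w}) = exp(−(2N+1))` (odd order: splitting
field ramified) and `v_w(tr g_w − 2b) = exp(−M)`: `log v_w(χ_g(u)_w) = −min(2N+1, 2M)` — so ★ (D2) reads `Δ‴_v = (−q)^{−min(2N+1, 2M)} κ_v` (Flicker's `n = min(1+2N, 2+2N₂)`,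
`M = N₂ + 1`). [cite: Flicker1998UnitaryFL, §6 Thm. 18 p. 97] [cite: Rogawski1990, §4.9 p. 55, Prop. 4.9.1 (b)] -/
theorem log_valued_eval_finCharpolyTwo_apply_eq_neg_min (h2 : Valued.v (2 : w.1.adicCompletion L) = 1) {N M : ℕ}
    (hN : Valued.v (((a.1.val.val : Matrix (Fin 2) (Fin 2) (UnitaryGroup.LocalRing L v)).map
          (Pi.evalRingHom (fun w' : UnitaryGroup.PlacesOver L v => w'.1.adicCompletion L) w)).trace ^ 2 -
        4 * ((a.1.val.val : Matrix (Fin 2) (Fin 2) (UnitaryGroup.LocalRing L v)).map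
          (Pi.evalRingHom (fun w' : UnitaryGroup.PlacesOver L v => w'.1.adicCompletion L) w)).det) =
      WithZero.exp (-((2 * N + 1 : ℕ) : ℤ)))
    (hM : Valued.v (((a.1.val.val : Matrix (Fin 2) (Fin 2) (UnitaryGroup.LocalRing L v)).map
          (Pi.evalRingHom (fun w' : UnitaryGroup.PlacesOver L v => w'.1.adicCompletion L) w)).trace - 2 * finGammaTwo L v a w) =
      WithZero.exp (-(M : ℤ))) :
    WithZero.log (Valued.v (((finCharpolyTwo L v a).eval (finGammaTwo L v a)) w)) = -((min (2 * N + 1) (2 * M) : ℕ) : ℤ) := by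
  rw [eval_finCharpolyTwo_finGammaTwo_apply_eq_quadratic L v w a]
  exact log_valued_quadratic_eval_eq_neg_min L v w h2 hN hM

omit [IsCMField L] in
/-- `IsUnit (2 : 𝒪_w)` (the stub's `h2`) read as `v_w(2) = 1`. [cite: Omeara1963, §11] -/
theorem valued_two_eq_one_of_isUnit (h2 : IsUnit (2 : 𝒪[w.1.adicCompletion L])) : Valued.v (2 : w.1.adicCompletion L) = 1 := by
  have h := (Valuation.integer.integers (Valued.v (R := w.1.adicCompletion L))).isUnit_iff_valuation_eq_one.1 h2
  rw [map_ofNat] at h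
  exact h

/-- **THE TYPE-(2) EXPONENT STUB** (B-p14 (g30) 04:42:03Z (4) `stub_irredExponents`): under the stub's `h2 : IsUnit (2 : 𝒪_w)`, integrality of `tr g_w` and of `b = u_w`, and
the odd order `2N + 1` of `disc χ_{g,w}`, there are `n M : ℕ` with `v_w(χ_g(u)_w) = exp(−n)` and `n = min(2N+1, 2M)` (`M := ord_w(tr g_w − 2b)`, capped at `N + 1` when
`tr g_w = 2b`). [cite: Flicker1998UnitaryFL, §6 Thm. 18 p. 97] [cite: Rogawski1990, §4.9 p. 55] -/
theorem exists_irredExponents (h2 : IsUnit (2 : 𝒪[w.1.adicCompletion L]))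
    (htr : Valued.v ((a.1.val.val : Matrix (Fin 2) (Fin 2) (UnitaryGroup.LocalRing L v)).map
          (Pi.evalRingHom (fun w' : UnitaryGroup.PlacesOver L v => w'.1.adicCompletion L) w)).trace ≤ 1)
    (hb : Valued.v (finGammaTwo L v a w) ≤ 1) {N : ℕ}
    (hN : Valued.v (((a.1.val.val : Matrix (Fin 2) (Fin 2) (UnitaryGroup.LocalRing L v)).map
          (Pi.evalRingHom (fun w' : UnitaryGroup.PlacesOver L v => w'.1.adicCompletion L) w)).trace ^ 2 -
        4 * ((a.1.val.val : Matrix (Fin 2) (Fin 2) (UnitaryGroup.LocalRing L v)).map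
          (Pi.evalRingHom (fun w' : UnitaryGroup.PlacesOver L v => w'.1.adicCompletion L) w)).det) =
      WithZero.exp (-((2 * N + 1 : ℕ) : ℤ))) :
    ∃ n M : ℕ, Valued.v (((finCharpolyTwo L v a).eval (finGammaTwo L v a)) w) = WithZero.exp (-(n : ℤ)) ∧ n = min (2 * N + 1) (2 * M) := by
  have h2' := valued_two_eq_one_of_isUnit L v w h2
  rw [eval_finCharpolyTwo_finGammaTwo_apply_eq_quadratic L v w a]
  set t := ((a.1.val.val : Matrix (Fin 2) (Fin 2) (UnitaryGroup.LocalRing L v)).map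
      (Pi.evalRingHom (fun w' : UnitaryGroup.PlacesOver L v => w'.1.adicCompletion L) w)).trace with ht
  by_cases htb : t = 2 * finGammaTwo L v a w
  · refine ⟨2 * N + 1, N + 1, valued_quadratic_eval_eq_exp_neg_of_eq L v w h2' hN htb, ?_⟩
    rw [min_eq_left (by omega)]
  · have hne : t - 2 * finGammaTwo L v a w ≠ 0 := sub_ne_zero.2 htb
    have hle : Valued.v (t - 2 * finGammaTwo L v a w) ≤ 1 := by
      refine (Valuation.map_sub _ _ _).trans (max_le htr ?_)
      rw [map_mul, h2', one_mul]; exact hb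
    obtain ⟨M, hM⟩ := exists_nat_valued_eq_exp_neg L v w hne hle
    exact ⟨min (2 * N + 1) (2 * M), M, valued_quadratic_eval_eq_exp_neg_min L v w h2' hN hM, rfl⟩

include hw in
open scoped Classical in
/-- **`Δ‴_v(γ_H, γ′) = (−q)^{−min(2N+1, 2M)} · κ_v(γ_H, γ′)` FOR THE IRREDUCIBLE TORUS** (★ (D2) with the exponent read by `log_valued_eval_finCharpolyTwo_apply_eq_neg_min`).
[cite: Flicker1998UnitaryFL, §6 Thm. 18 p. 97] [cite: Rogawski1990, §4.9 p. 55, Prop. 4.9.1 (b)] -/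
theorem finExplicitDelta_eq_neg_absNorm_zpow_neg_min_mul_kappa (μ : HeckeCharacter L)
    (hμω : ∀ x : ideleGroup ↥(maximalRealSubfield L), μ (AdeleRing.ideleBaseChange ↥(maximalRealSubfield L) L x) = quadraticHeckeCharCM L x)
    (hunr : Algebra.IsUnramifiedIn (𝓞 L) v.asIdeal) (hμ : μ.IsUnramifiedAt w.1) (h : IsLocalNormPair L H' v a b)
    (hu : IsUnit ((finCharpolyTwo L v a).eval (finGammaTwo L v a))) (h2 : Valued.v (2 : w.1.adicCompletion L) = 1) {N M : ℕ}
    (hN : Valued.v (((a.1.val.val : Matrix (Fin 2) (Fin 2) (UnitaryGroup.LocalRing L v)).map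
          (Pi.evalRingHom (fun w' : UnitaryGroup.PlacesOver L v => w'.1.adicCompletion L) w)).trace ^ 2 -
        4 * ((a.1.val.val : Matrix (Fin 2) (Fin 2) (UnitaryGroup.LocalRing L v)).map
          (Pi.evalRingHom (fun w' : UnitaryGroup.PlacesOver L v => w'.1.adicCompletion L) w)).det) =
      WithZero.exp (-((2 * N + 1 : ℕ) : ℤ)))
    (hM : Valued.v (((a.1.val.val : Matrix (Fin 2) (Fin 2) (UnitaryGroup.LocalRing L v)).map
          (Pi.evalRingHom (fun w' : UnitaryGroup.PlacesOver L v => w'.1.adicCompletion L) w)).trace - 2 * finGammaTwo L v a w) =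
      WithZero.exp (-(M : ℤ))) :
    finExplicitDelta L v H' a μ b = (-(Ideal.absNorm v.asIdeal : ℂ)) ^ (-((min (2 * N + 1) (2 * M) : ℕ) : ℤ)) * ((finKappaAt L v H' a b : ℤ) : ℂ) := by
  have hD := finExplicitDelta_eq_neg_absNorm_zpow_mul_kappa_of_nonsplit_of_isUnramifiedIn L v H' a b w hw μ hμω hunr hμ h hu
  have hlog := log_valued_eval_finCharpolyTwo_apply_eq_neg_min L v w a h2 hN hM
  rw [hD, hlog]

end IrredTorus

end Literature.NumberTheory.Rogawski1990

end
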